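import Mathlib
import Literature.Analysis.OperatorTheory.HilbertBasisSchurTest
import Literature.Analysis.UnboundedOperators.DiagonalOperatorCompact
import Summits.NavierStokesRegularity.FluidComputer.BorderedEigenpairSectionsBand
import Summits.NavierStokesRegularity.FluidComputer.BorderedEigenpairMasterNested
import Summits.NavierStokesRegularity.FluidComputer.SkewCutGalerkinPerturbation
import Summits.NavierStokesRegularity.FluidComputer.SkewCutGalerkinTailForm

/-!
# THEOREM 3-B-NESTED END-TO-END FROM MATRIX DATA (diagonal / Hilbert-basis setting)
(profile-cert-3 g5, cell `ns-blowup`, 2026-08-26)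

HONEST FRAMING (human rulings D-0035/D-0074): nothing here is a claim about Navier–Stokes blow-up.
WHAT THIS IS NOT: not NS evidence. MODEL lane bookkeeping about the FORMAT of the F5 eigenpair
certificates of GROUP B (`CertificateAbcSpectrum*`, three implementations; cap `SKEWCUT-PAIR.md` §9
(N1)–(N7)). `BorderedEigenpairMasterNested.certified_eigenpair_of_row_nested` (p456694) +
`BorderedEigenpairSections` (p463050) + `BorderedEigenpairSectionsBand` composed: the GROUP-B twin
of instab4's `SkewCutGalerkinFromSections.exists_smooth_eigenvector_Ioo_of_sections` (p446013).

INPUTS of `certified_eigenpair_of_sections_nested` — everything a certifier holds: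
* the free part `ℓ` (for the model `ℓ_i = −ν|k_i|²`) through its resolvent symbol `d`,
  `d_i (x₀ − ℓ_i) = 1`, `d_i → 0` (Rellich by the tree's `isCompactOperator_diagonalCLM_of_tendsto_zero`);
* the MATRIX `t` of the relative bound with Schur data `R₀ C₀ < 1` and a symmetric band `nbr`
  (the first-order matrix is `a_ij = t_ij (x₀ − ℓ_j)`; `T` is BUILT by the tree's Schur test
  p441463, `⟪b i, T b j⟫ = t_ij`);
* the float datum: `λ̃ ∈ 𝕜` and the coefficient vector `ṽ` supported on a finite `K_v` (head `K`;
  the rows of record have `K ⊆ K_v`, not needed here),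
  its RESIDUAL in coordinates `Σ_i |[i ∈ K_v](λ̃ − ℓ_i)ṽ_i − Σ_{j∈K_v} a_ij ṽ_j|² ≤ r₀²` and tail mass
  `Σ_{i ∈ K_v ∖ K} |ṽ_i|² ≤ n_t²` (`‖ṽ_t‖`);
* a left inverse `Binv` of the BORDERED GALERKIN MATRIX `𝔅_K` with the four matrix bounds `α`
  (`‖Binv‖`), `β_B` (`‖Binv ∘ [−B_K ; 0]‖` on the first outer shell), nested `β_C′`
  (`‖[−C_K, ṽ_t] ∘ Binv‖`), `g_B` (`|e_μ* Binv [B_K ; 0]|`);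
* the tail numbers: a certified SHELL inequality on a finite `sh` with constant `MU2` (cross term through
  the bordered head included, in coordinates), the TAIL CONSTANT `MU2 ≤ Re λ̃ − ℓ_i − s` beyond,
  `μ := MU2 − g_B n_t > 0` ((N4) `μ_eff`), and `κ = 2√2 M₀² r₀ < 1` with the printed `M₀`;
* ONE structural input left in operator form, as in instab4's chain: the strain-type PAIRING bound
  `Re ⟪T w, S₀ w⟫ ≤ s ‖S₀ w‖²` on the tail for the operator with matrix `t` ((F1)+(F2), Lemma S,
  `s = √2` — kernel for the model by instab4 g5's `AbcLatticePairing*` / `AbcLatticeTailCoercivity`).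
CONCLUSION: the printed «3-B CERTIFIED» sentence of p456694 for `L₀ + A` in resolvent coordinates —
EXACTLY ONE normalised eigenpair within `ρ = 2 M₀ r₀` of `(ṽ, λ̃)`, algebraically simple, `R_z`
invertible on `0 < |z − λ⋆| < (1 − κ)/M₀`.

What stays model-specific after this file (identical to GROUP A's residue, instab4 KERNEL-CHAIN §4): the
class-II Craya / orbit-pair BASIS in which the certifiers' matrices ARE `[ℓ δ + a]` (definitions,
instab3 `AbcCrayaFrames`), the pairing bound for the model (kernel, instab4 g5), and the transcribed
numbers (certifier audit). Mathlib + the files named; no new definitions. bears_on LADDER-NS N5 /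
Z4-a(1)(2); evidence-only for `EpisodeBase` (stmt-NavierStokesRegularity-19179). [folklore] throughout.
-/

noncomputable section

namespace Summit.NavierStokesRegularity.FluidComputer.BorderedEigenpairFromSections

open Filter Topology Submodule BorderedEigenpairSections BorderedEigenpairSectionsBand
open scoped InnerProductSpace ComplexConjugate

variable {𝕜 H : Type*} [RCLike 𝕜] [NormedAddCommGroup H] [InnerProductSpace 𝕜 H] [CompleteSpace H]
variable {ι : Type*} (b : HilbertBasis ι 𝕜 H) [DecidableEq ι]

/-! ## §1 A banded Schur matrix acts by finite sums in coordinates -/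

omit [CompleteSpace H] [DecidableEq ι] in
/-- If `⟪b i, T x⟫ = Σ' j, t_ij ⟪b j, x⟫` (the coordinate formula of the Schur-test operator) and
`t_ij = 0` off a finite band `nbr i`, then `⟪b i, T x⟫ = Σ_{j ∈ nbr i} ⟪b i, T b j⟫ ⟪b j, x⟫`. -/
theorem band_formula_of_coord (T : H →L[𝕜] H) (t : ι → ι → 𝕜)
    (hcoord : ∀ x i, b.repr (T x) i = ∑' j, t i j * b.repr x j)
    (hTt : ∀ i j, ⟪b i, T (b j)⟫_𝕜 = t i j) (nbr : ι → Finset ι)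
    (ht0 : ∀ i j, j ∉ nbr i → t i j = 0) (i : ι) (x : H) :
    ⟪b i, T x⟫_𝕜 = ∑ j ∈ nbr i, ⟪b i, T (b j)⟫_𝕜 * ⟪b j, x⟫_𝕜 := by
  rw [← b.repr_apply_apply, hcoord x i, tsum_eq_sum (s := nbr i) fun j hj => by
    rw [ht0 i j hj, zero_mul]]
  exact Finset.sum_congr rfl fun j _ => by rw [hTt, b.repr_apply_apply]

/-! ## §2 The residual, the cross term and the rank-one input in coordinates -/

/-- **Residual in coordinates.** For a coefficient vector `ṽ` supported on a finite `K_v` and the float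
vector `w̃ = Σ_{j∈K_v} ((x₀ − ℓ_j) ṽ_j) b_j` (so `S₀ w̃ = Σ ṽ_j b_j`), with `T` banded (symmetric band):
`‖R w̃‖² = Σ_{i ∈ K_v ∪ ⋃_{j∈K_v} nbr j} |[i ∈ K_v](λ̃ − ℓ_i) ṽ_i − Σ_{j∈K_v} a_ij ṽ_j|²`. -/
theorem residual_norm_sq_eq (ℓ : ι → ℝ) (x₀ : ℝ) (d : lp (fun _ : ι => 𝕜) ⊤)
    (hd : ∀ i, d i * ((x₀ : 𝕜) - (ℓ i : 𝕜)) = 1) (T : H →L[𝕜] H) (lt : 𝕜)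
    (nbr : ι → Finset ι) (hsymm : ∀ i j, j ∈ nbr i ↔ i ∈ nbr j)
    (hTband : ∀ (i : ι) (x : H), ⟪b i, T x⟫_𝕜 = ∑ j ∈ nbr i, ⟪b i, T (b j)⟫_𝕜 * ⟪b j, x⟫_𝕜)
    (Kv : Finset ι) (vt : ι → 𝕜) :
    ‖((1 : H →L[𝕜] H) - T - ((x₀ : 𝕜) - lt) • b.diagonalCLM d)
        (∑ j ∈ Kv, (((x₀ : 𝕜) - (ℓ j : 𝕜)) * vt j) • b j)‖ ^ 2 =
      ∑ i ∈ Kv ∪ Kv.biUnion nbr, ‖(if i ∈ Kv then (lt - (ℓ i : 𝕜)) * vt i else 0) -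
        ∑ j ∈ Kv, (⟪b i, T (b j)⟫_𝕜 * ((x₀ : 𝕜) - (ℓ j : 𝕜))) * vt j‖ ^ 2 := by
  have hcoord := inner_basis_resolventCoord_headVector b ℓ x₀ d hd T lt Kv vt
  rw [norm_sq_eq_sum_of_support b (Kv ∪ Kv.biUnion nbr)]
  · exact Finset.sum_congr rfl fun i _ => by rw [hcoord]
  · intro i hi
    rw [Finset.mem_union, not_or] at hi
    rw [hcoord, if_neg hi.1, zero_sub, neg_eq_zero]
    refine Finset.sum_eq_zero fun j hj => ?_
    have ht : ⟪b i, T (b j)⟫_𝕜 = 0 := by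
      refine matrix_eq_zero_of_not_mem_band b T nbr hTband fun hji => hi.2 ?_
      exact Finset.mem_biUnion.mpr ⟨j, hj, (hsymm i j).mp hji⟩
    rw [ht, zero_mul, zero_mul]

/-- **Head datum of a tail vector in coordinates** (no sign): for `w ∈ U_Kᗮ`, `e_i = ⟪b i, S₀ w⟫`,
the head coordinates of `P (T w)` are `(B_K e)_i = Σ_{j ∈ nbr i ∖ K} a_ij e_j`. -/
theorem head_coord_T_tail (ℓ : ι → ℝ) (x₀ : ℝ) (d : lp (fun _ : ι => 𝕜) ⊤)
    (hd : ∀ i, d i * ((x₀ : 𝕜) - (ℓ i : 𝕜)) = 1) (T : H →L[𝕜] H) (K : Finset ι)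
    (nbr : ι → Finset ι)
    (hTband : ∀ (i : ι) (x : H), ⟪b i, T x⟫_𝕜 = ∑ j ∈ nbr i, ⟪b i, T (b j)⟫_𝕜 * ⟪b j, x⟫_𝕜)
    {w : H} (hw : w ∈ ((span 𝕜 (b '' (K : Set ι))).topologicalClosure)ᗮ) :
    (fun i : K => ⟪b i, (span 𝕜 (b '' (K : Set ι))).topologicalClosure.starProjection (T w)⟫_𝕜) =
      fun i : K => ∑ j ∈ nbr i \ K, (⟪b i, T (b j)⟫_𝕜 * ((x₀ : 𝕜) - (ℓ j : 𝕜))) *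
        ⟪b j, b.diagonalCLM d w⟫_𝕜 := by
  have hSw0 : ∀ i ∈ K, ⟪b i, b.diagonalCLM d w⟫_𝕜 = 0 :=
    (mem_orthogonal_closure_span_iff b K _).mp (diagonalCLM_mem_orthogonal_closure_span b d K hw)
  funext i
  rw [inner_basis_starProjection, if_pos i.2, inner_basis_T_eq_sum_band b ℓ x₀ d hd T nbr hTband w i]
  refine (Finset.sum_subset Finset.sdiff_subset fun j hj hj' => ?_).symm
  have hjK : j ∈ K := by
    by_contra h
    exact hj' (Finset.mem_sdiff.mpr ⟨hj, h⟩)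
  rw [hSw0 j hjK, mul_zero]

omit [CompleteSpace H] in
/-- **Cross term in coordinates.** For `w ∈ U_Kᗮ` (`e_i = ⟪b i, S₀ w⟫`) and a head vector
`u = Σ_{j∈K} ((x₀ − ℓ_j) z_j) b_j` (the head solution), `T` banded with symmetric band:
`⟪T u, S₀ w⟫ = Σ_{i ∈ K_out} conj(Σ_{j∈K} a_ij z_j) e_i`, `K_out = (⋃_{j∈K} nbr j) ∖ K` — only the leak
of `u` into the first outer shell pairs with the tail vector. -/
theorem cross_eq_sum (S₀ T : H →L[𝕜] H) (ℓ : ι → ℝ) (x₀ : ℝ) (K : Finset ι) (nbr : ι → Finset ι)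
    (hsymm : ∀ i j, j ∈ nbr i ↔ i ∈ nbr j)
    (hTband : ∀ (i : ι) (x : H), ⟪b i, T x⟫_𝕜 = ∑ j ∈ nbr i, ⟪b i, T (b j)⟫_𝕜 * ⟪b j, x⟫_𝕜)
    (z : K → 𝕜) {w : H} (hSw : S₀ w ∈ ((span 𝕜 (b '' (K : Set ι))).topologicalClosure)ᗮ) :
    ⟪T (∑ j : K, (((x₀ : 𝕜) - (ℓ j : 𝕜)) * z j) • b (j : ι)), S₀ w⟫_𝕜 =
      ∑ i ∈ K.biUnion nbr \ K, conj (∑ j : K, (⟪b i, T (b j)⟫_𝕜 * ((x₀ : 𝕜) - (ℓ j : 𝕜))) * z j) *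
        ⟪b i, S₀ w⟫_𝕜 := by
  set u : H := ∑ j : K, (((x₀ : 𝕜) - (ℓ j : 𝕜)) * z j) • b (j : ι) with hu
  have hSw0 : ∀ i ∈ K, ⟪b i, S₀ w⟫_𝕜 = 0 := (mem_orthogonal_closure_span_iff b K _).mp hSw
  -- coordinates of `T u` by linearity (finite sum)
  have hTu : ∀ i, ⟪b i, T u⟫_𝕜 = ∑ j : K, (⟪b i, T (b j)⟫_𝕜 * ((x₀ : 𝕜) - (ℓ j : 𝕜))) * z j := by
    intro i
    rw [hu, map_sum, inner_sum]
    exact Finset.sum_congr rfl fun j _ => by rw [map_smul, inner_smul_right]; ring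
  -- Parseval, then reduce the series to the outer shell
  rw [← b.tsum_inner_mul_inner (T u) (S₀ w)]
  rw [tsum_eq_sum (s := K.biUnion nbr \ K)]
  · refine Finset.sum_congr rfl fun i _ => ?_
    rw [← inner_conj_symm (T u) (b i), hTu]
  · intro i hi
    by_cases hiK : i ∈ K
    · rw [hSw0 i hiK, mul_zero]
    · have hi' : i ∉ K.biUnion nbr := fun h => hi (Finset.mem_sdiff.mpr ⟨h, hiK⟩)
      have ht : ∀ j : K, ⟪b i, T (b j)⟫_𝕜 = 0 := fun j => by
        refine matrix_eq_zero_of_not_mem_band b T nbr hTband fun hji => hi' ?_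
        exact Finset.mem_biUnion.mpr ⟨j, j.2, (hsymm i j).mp hji⟩
      rw [← inner_conj_symm (T u) (b i), hTu,
        Finset.sum_eq_zero fun j _ => by rw [ht j, zero_mul, zero_mul], map_zero, zero_mul]

/-! ## §3 END-TO-END: the 3-B-NESTED sentence from matrix data -/

/-- **THEOREM 3-B-NESTED from matrix data** (see the module docstring for the dictionary). The
unknowns are in resolvent coordinates: `S₀ = diag(d)`, `R_z = 1 − T − (x₀ − z) S₀`, `D(L) = range S₀`,
`(z − L)(S₀ w) = R_z w`; the float vector is `w̃ = Σ_{j∈K_v} ((x₀ − ℓ_j) ṽ_j) b_j` (`S₀ w̃ = ṽ`), the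
row vector `ṽ_h = Σ_{i∈K} ṽ_i b_i`, `μ = MU2 − g_B n_t`,
`M = √((1 + β_C²)/μ² + (α + β_B √(1 + β_C²)/μ)²)`. CONCLUSIONS (for the operator `T` built from
`t` by the Schur test, unique with `⟪b i, T b j⟫ = t_ij`): (b) EXACTLY ONE normalised eigenpair
`(λ⋆, w⋆)` with `‖S₀ w⋆ − ṽ‖² + |λ⋆ − λ̃|² ≤ (2 M r₀)²`, `⟪ṽ_h, S₀ w⋆⟫ = ⟪ṽ_h, ṽ⟫`;
(c) `ker R_λ⋆ = span{w⋆}` and no Jordan chain; (d) `R_z` invertible for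
`0 < |z − λ⋆| < (1 − 2√2 M² r₀)/M`. -/
theorem certified_eigenpair_of_sections_nested
    -- free part and its resolvent symbol
    (ℓ : ι → ℝ) (x₀ : ℝ) (d : lp (fun _ : ι => 𝕜) ⊤) (hd : ∀ i, d i * ((x₀ : 𝕜) - (ℓ i : 𝕜)) = 1)
    (hd0 : Tendsto (fun i => ‖d i‖) cofinite (𝓝 0))
    -- the matrix of the relative bound: Schur data and symmetric band
    (t : ι → ι → 𝕜) {R₀ C₀ : ℝ} (hrow : ∀ i, Summable fun j => ‖t i j‖)
    (hR : ∀ i, ∑' j, ‖t i j‖ ≤ R₀) (hcol : ∀ j, Summable fun i => ‖t i j‖)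
    (hC₀ : ∀ j, ∑' i, ‖t i j‖ ≤ C₀) (hR0 : 0 ≤ R₀) (hC0 : 0 ≤ C₀) (hq : R₀ * C₀ < 1)
    (nbr : ι → Finset ι) (hsymm : ∀ i j, j ∈ nbr i ↔ i ∈ nbr j)
    (ht0 : ∀ i j, j ∉ nbr i → t i j = 0)
    -- the float datum: `λ̃`, head `K`, coefficient vector `ṽ` supported on `K_v` (typically `K_v ⊇ K`)
    (lt : 𝕜) (K Kv : Finset ι) (vt : ι → 𝕜) (hvt0 : ∀ i, i ∉ Kv → vt i = 0)
    {r₀ nt : ℝ} (hr₀ : 0 ≤ r₀) (hnt : 0 ≤ nt)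
    (hres : ∑ i ∈ Kv ∪ Kv.biUnion nbr, ‖(if i ∈ Kv then (lt - (ℓ i : 𝕜)) * vt i else 0) -
        ∑ j ∈ Kv, (t i j * ((x₀ : 𝕜) - (ℓ j : 𝕜))) * vt j‖ ^ 2 ≤ r₀ ^ 2)
    (hntb : ∑ i ∈ Kv \ K, ‖vt i‖ ^ 2 ≤ nt ^ 2)
    -- the bordered Galerkin matrix: a left inverse and its four certified bounds
    (Binv : ((K → 𝕜) × 𝕜) →ₗ[𝕜] ((K → 𝕜) × 𝕜))
    (hBinv : ∀ (c : K → 𝕜) (m : 𝕜),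
      Binv (fun i : K => (lt - (ℓ i : 𝕜)) * c i -
          ∑ j : K, (t i j * ((x₀ : 𝕜) - (ℓ j : 𝕜))) * c j + m * vt i,
        ∑ i : K, conj (vt i) * c i) = (c, m))
    {α βB βC gB : ℝ} (hα : 0 ≤ α) (hβB : 0 ≤ βB) (hβC : 0 ≤ βC) (hgB : 0 ≤ gB)
    (hαM : ∀ (c : K → 𝕜) (g : 𝕜),
      ∑ j : K, ‖(Binv (c, g)).1 j‖ ^ 2 + ‖(Binv (c, g)).2‖ ^ 2 ≤
        α ^ 2 * (∑ i : K, ‖c i‖ ^ 2 + ‖g‖ ^ 2))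
    (hβBM : ∀ e : ι → 𝕜,
      ∑ j : K, ‖(Binv (fun i : K => -∑ j ∈ nbr i \ K,
          (t i j * ((x₀ : 𝕜) - (ℓ j : 𝕜))) * e j, 0)).1 j‖ ^ 2 +
        ‖(Binv (fun i : K => -∑ j ∈ nbr i \ K,
          (t i j * ((x₀ : 𝕜) - (ℓ j : 𝕜))) * e j, 0)).2‖ ^ 2 ≤
        βB ^ 2 * ∑ j ∈ K.biUnion nbr \ K, ‖e j‖ ^ 2)
    (hβCM : ∀ (c : K → 𝕜) (g : 𝕜),
      ∑ i ∈ (K.biUnion nbr ∪ Kv) \ K,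
        ‖-∑ j : K, (t i j * ((x₀ : 𝕜) - (ℓ j : 𝕜))) * (Binv (c, g)).1 j +
          (Binv (c, g)).2 * vt i‖ ^ 2 ≤ βC ^ 2 * (∑ i : K, ‖c i‖ ^ 2 + ‖g‖ ^ 2))
    (hgBM : ∀ e : ι → 𝕜,
      ‖(Binv (fun i : K => ∑ j ∈ nbr i \ K, (t i j * ((x₀ : 𝕜) - (ℓ j : 𝕜))) * e j, 0)).2‖ ^ 2 ≤
        gB ^ 2 * ∑ j ∈ K.biUnion nbr \ K, ‖e j‖ ^ 2)
    -- the tail numbers: shell inequality (cross term in coordinates), tail constant, `μ`, `M`, `κ`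
    {s MU2 μ M : ℝ} (sh : Finset ι)
    (hshellM : ∀ e : ι → 𝕜, (∀ i ∈ K, e i = 0) →
      MU2 * ∑ i ∈ sh, ‖e i‖ ^ 2 ≤ ∑ i ∈ sh, (RCLike.re lt - ℓ i - s) * ‖e i‖ ^ 2 -
        RCLike.re (∑ i ∈ K.biUnion nbr \ K,
          conj (∑ j : K, (t i j * ((x₀ : 𝕜) - (ℓ j : 𝕜))) *
            (Binv (fun i : K => ∑ j ∈ nbr i \ K, (t i j * ((x₀ : 𝕜) - (ℓ j : 𝕜))) * e j, 0)).1 j) *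
          e i))
    (htail : ∀ i, i ∉ K → i ∉ sh → MU2 ≤ RCLike.re lt - ℓ i - s)
    (hμdef : μ = MU2 - gB * nt) (hμ : 0 < μ)
    (hMdef : M = √((1 + βC ^ 2) / μ ^ 2 + (α + βB * √(1 + βC ^ 2) / μ) ^ 2))
    (hκ : 2 * Real.sqrt 2 * M ^ 2 * r₀ < 1)
    -- the structural pairing bound for the operator with matrix `t` ((F1)+(F2), Lemma S)
    (hpair : ∀ T : H →L[𝕜] H, (∀ i j, ⟪b i, T (b j)⟫_𝕜 = t i j) →
      (∀ (i : ι) (x : H), ⟪b i, T x⟫_𝕜 = ∑ j ∈ nbr i, t i j * ⟪b j, x⟫_𝕜) →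
      ∀ w ∈ ((span 𝕜 (b '' (K : Set ι))).topologicalClosure)ᗮ,
        RCLike.re ⟪T w, b.diagonalCLM d w⟫_𝕜 ≤ s * ‖b.diagonalCLM d w‖ ^ 2) :
    ∃ T : H →L[𝕜] H, (∀ i j, ⟪b i, T (b j)⟫_𝕜 = t i j) ∧ ‖T‖ ≤ Real.sqrt (R₀ * C₀) ∧
    ∃ lam : 𝕜, ∃ ws : H,
      (((1 : H →L[𝕜] H) - T - ((x₀ : 𝕜) - lam) • b.diagonalCLM d) ws = 0 ∧
        ‖b.diagonalCLM d ws - ∑ j ∈ Kv, vt j • b j‖ ^ 2 + ‖lam - lt‖ ^ 2 ≤ (2 * M * r₀) ^ 2 ∧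
        ⟪∑ i ∈ K, vt i • b i, b.diagonalCLM d ws⟫_𝕜 = ⟪∑ i ∈ K, vt i • b i, ∑ j ∈ Kv, vt j • b j⟫_𝕜) ∧
      (∀ (lam' : 𝕜) (w' : H), ((1 : H →L[𝕜] H) - T - ((x₀ : 𝕜) - lam') • b.diagonalCLM d) w' = 0 →
        ‖b.diagonalCLM d w' - ∑ j ∈ Kv, vt j • b j‖ ^ 2 + ‖lam' - lt‖ ^ 2 ≤ (2 * M * r₀) ^ 2 →
        ⟪∑ i ∈ K, vt i • b i, b.diagonalCLM d w'⟫_𝕜 = ⟪∑ i ∈ K, vt i • b i, ∑ j ∈ Kv, vt j • b j⟫_𝕜 →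
        lam' = lam ∧ w' = ws) ∧
      (∀ y : H, ((1 : H →L[𝕜] H) - T - ((x₀ : 𝕜) - lam) • b.diagonalCLM d) y = 0 →
        y = (⟪∑ i ∈ K, vt i • b i, b.diagonalCLM d y⟫_𝕜 /
          ⟪∑ i ∈ K, vt i • b i, b.diagonalCLM d ws⟫_𝕜) • ws) ∧
      (∀ y₁ y₂ : H, ((1 : H →L[𝕜] H) - T - ((x₀ : 𝕜) - lam) • b.diagonalCLM d) y₁ =
          b.diagonalCLM d y₂ →
        ((1 : H →L[𝕜] H) - T - ((x₀ : 𝕜) - lam) • b.diagonalCLM d) y₂ = 0 → y₂ = 0) ∧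
      (∀ z : 𝕜, z ≠ lam → ‖z - lam‖ < (1 - 2 * Real.sqrt 2 * M ^ 2 * r₀) / M →
        IsUnit ((1 : H →L[𝕜] H) - T - ((x₀ : 𝕜) - z) • b.diagonalCLM d)) := by
  -- build `T` by the Schur test; band formula; `‖T‖ < 1`
  obtain ⟨T, hcoordT, -, hTt, hTn, -⟩ :=
    Literature.Analysis.OperatorTheory.HilbertBasisSchurTest.exists_clm_of_schur_bound b t hrow hR
      hcol hC₀ hR0 hC0
  have hT1 : ‖T‖ < 1 := by
    refine lt_of_le_of_lt hTn ?_
    rw [show (1 : ℝ) = Real.sqrt 1 from Real.sqrt_one.symm]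
    exact Real.sqrt_lt_sqrt (mul_nonneg hR0 hC0) hq
  have hTu : IsUnit ((1 : H →L[𝕜] H) - T) := isUnit_one_sub_of_norm_lt_one hT1
  have hTband : ∀ (i : ι) (x : H), ⟪b i, T x⟫_𝕜 = ∑ j ∈ nbr i, ⟪b i, T (b j)⟫_𝕜 * ⟪b j, x⟫_𝕜 :=
    band_formula_of_coord b T t hcoordT hTt nbr ht0
  have hTband' : ∀ (i : ι) (x : H), ⟪b i, T x⟫_𝕜 = ∑ j ∈ nbr i, t i j * ⟪b j, x⟫_𝕜 :=
    fun i x => by rw [hTband]; simp_rw [hTt]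
  -- rewrite the matrix hypotheses in terms of `⟪b i, T b j⟫`
  simp only [← hTt] at hres hBinv hβBM hβCM hgBM hshellM
  refine ⟨T, hTt, hTn, ?_⟩
  -- the setting
  set S₀ : H →L[𝕜] H := b.diagonalCLM d with hS₀
  set U : Submodule 𝕜 H := (span 𝕜 (b '' (K : Set ι))).topologicalClosure with hU
  have hS₀c : IsCompactOperator S₀ := b.isCompactOperator_diagonalCLM_of_tendsto_zero d hd0
  have hS₀inj : Function.Injective S₀ := (injective_iff_map_eq_zero _).mpr
    (SkewCutGalerkinTailForm.diagonalCLM_injective_of_resolvent b ℓ x₀ d hd)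
  have hS₀U : ∀ u ∈ U, S₀ u ∈ U := fun u hu =>
    SkewCutGalerkinPerturbation.diagonalCLM_mem_closure_span b d (K : Set ι) hu
  have hS₀U' : ∀ w ∈ Uᗮ, S₀ w ∈ Uᗮ := fun w hw => diagonalCLM_mem_orthogonal_closure_span b d K hw
  -- float vector, column and row vectors
  set wt : H := ∑ j ∈ Kv, (((x₀ : 𝕜) - (ℓ j : 𝕜)) * vt j) • b j with hwt
  have hvc : S₀ wt = ∑ j ∈ Kv, vt j • b j := (headVector_mem_and_diag b ℓ x₀ d hd Kv vt).2
  have hvc_i : ∀ i, ⟪b i, S₀ wt⟫_𝕜 = vt i := fun i => by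
    rw [hvc, SkewCutGalerkinSections.inner_basis_sum_smul]
    split_ifs with hi
    · rfl
    · exact (hvt0 i hi).symm
  set vr : H := ∑ i ∈ K, vt i • b i with hvr_def
  have hvr : vr ∈ U := (span 𝕜 (b '' (K : Set ι))).le_topologicalClosure
    (sum_mem fun i hi => smul_mem _ _ (subset_span ⟨i, hi, rfl⟩))
  have hvr_i : ∀ i : K, ⟪b (i : ι), vr⟫_𝕜 = vt i := fun i => by
    rw [hvr_def, SkewCutGalerkinSections.inner_basis_sum_smul, if_pos i.2]
  -- the head inverse
  obtain ⟨Ainv, hAform, hAhead, hAleft⟩ := exists_nestedHeadInverse_of_matrix b ℓ x₀ d hd T lt K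
    (S₀ wt) vr hvr Binv (fun c m => by simp only [hvc_i, hvr_i]; exact hBinv c m)
  have hA1 : ∀ (y : H) (g : 𝕜),
      S₀ (Ainv (y, g)).1 = ∑ j : K, (Binv (fun i : K => ⟪b i, y⟫_𝕜, g)).1 j • b j :=
    fun y g => (hAhead y g).2
  have hA1' := fun y g => (hAform y g).1
  have hA2 : ∀ (y : H) (g : 𝕜), (Ainv (y, g)).2 = (Binv (fun i : K => ⟪b i, y⟫_𝕜, g)).2 :=
    fun y g => (hAform y g).2
  have hAinvU : ∀ (y : H) (g : 𝕜), (Ainv (y, g)).1 ∈ U := fun y g => (hAhead y g).1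
  -- the three head constants
  have hαb := head_alpha_bound_of_matrix b S₀ K Binv Ainv hA1 hA2 hα hαM
  have hβBb := head_betaB_bound_of_matrix b ℓ x₀ d hd T lt K nbr hTband Binv Ainv hA1 hA2 hβB hβBM
  have hβCb := head_betaC_bound_of_matrix b ℓ x₀ d hd T lt K nbr hsymm hTband (S₀ wt) Kv
    (fun i hi => by rw [hvc_i, hvt0 i hi]) Binv Ainv hA1' hA2 hβC
    (fun c g => by simp only [hvc_i]; exact hβCM c g)
  -- the tail coercivity with `μ = MU2 - gB nt`
  have hnt' : ‖S₀ wt - U.starProjection (S₀ wt)‖ ≤ nt := by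
    have h2 : ‖S₀ wt - U.starProjection (S₀ wt)‖ ^ 2 ≤ nt ^ 2 := by
      have hXi : ∀ i, ⟪b i, S₀ wt - U.starProjection (S₀ wt)⟫_𝕜 =
          if i ∈ K then 0 else vt i := fun i => by
        rw [inner_sub_right, inner_basis_starProjection, hvc_i]
        split_ifs <;> ring
      rw [norm_sq_eq_sum_of_support b (Kv \ K) (fun i hi => by
        rw [hXi]
        split_ifs with hiK
        · rfl
        · exact hvt0 i fun h => hi (Finset.mem_sdiff.mpr ⟨h, hiK⟩))]
      refine le_trans (le_of_eq (Finset.sum_congr rfl fun i hi => ?_)) hntb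
      rw [hXi, if_neg (Finset.mem_sdiff.mp hi).2]
    exact (pow_le_pow_iff_left₀ (norm_nonneg _) hnt two_ne_zero).mp h2
  have hcoer : ∀ w ∈ Uᗮ, μ * ‖S₀ w‖ ^ 2 ≤
      RCLike.re ⟪((1 : H →L[𝕜] H) - T - ((x₀ : 𝕜) - lt) • S₀) w -
        ((1 : H →L[𝕜] H) - T - ((x₀ : 𝕜) - lt) • S₀)
          (Ainv (U.starProjection (((1 : H →L[𝕜] H) - T - ((x₀ : 𝕜) - lt) • S₀) w), 0)).1 -
        (Ainv (U.starProjection (((1 : H →L[𝕜] H) - T - ((x₀ : 𝕜) - lt) • S₀) w), 0)).2 •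
          (S₀ wt - U.starProjection (S₀ wt)), S₀ w⟫_𝕜 := by
    intro w hw
    have hSw : S₀ w ∈ Uᗮ := hS₀U' w hw
    set e : ι → 𝕜 := fun i => ⟪b i, S₀ w⟫_𝕜 with he
    have he0 : ∀ i ∈ K, e i = 0 := (mem_orthogonal_closure_span_iff b K _).mp hSw
    have hB1 := head_coord_T_tail b ℓ x₀ d hd T K nbr hTband hw
    -- head solution and rank-one input in coordinates
    set z : K → 𝕜 := (Binv (fun i : K => ∑ j ∈ nbr i \ K,
      (⟪b i, T (b j)⟫_𝕜 * ((x₀ : 𝕜) - (ℓ j : 𝕜))) * e j, 0)).1 with hz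
    have ha1 : (Ainv (U.starProjection (T w), 0)).1 =
        ∑ j : K, (((x₀ : 𝕜) - (ℓ j : 𝕜)) * z j) • b (j : ι) := by
      rw [hA1', hB1]
    have ha2 : (Ainv (U.starProjection (T w), 0)).2 = (Binv (fun i : K => ∑ j ∈ nbr i \ K,
        (⟪b i, T (b j)⟫_𝕜 * ((x₀ : 𝕜) - (ℓ j : 𝕜))) * e j, 0)).2 := by
      rw [hA2, hB1]
    have hcross : ⟪T (Ainv (U.starProjection (T w), 0)).1, S₀ w⟫_𝕜 =
        ∑ i ∈ K.biUnion nbr \ K, conj (∑ j : K, (⟪b i, T (b j)⟫_𝕜 * ((x₀ : 𝕜) - (ℓ j : 𝕜))) *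
          z j) * e i := by
      rw [ha1]
      exact cross_eq_sum b S₀ T ℓ x₀ K nbr hsymm hTband z hSw
    have hbessel : ∑ j ∈ K.biUnion nbr \ K, ‖e j‖ ^ 2 ≤ ‖S₀ w‖ ^ 2 := sum_norm_sq_inner_le b _ _
    have hrank : ‖(Ainv (U.starProjection (T w), 0)).2‖ ≤ gB * ‖S₀ w‖ := by
      have h2 : ‖(Ainv (U.starProjection (T w), 0)).2‖ ^ 2 ≤ (gB * ‖S₀ w‖) ^ 2 := by
        rw [ha2, mul_pow]
        exact (hgBM e).trans (mul_le_mul_of_nonneg_left hbessel (sq_nonneg _))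
      exact (pow_le_pow_iff_left₀ (norm_nonneg _) (by positivity) two_ne_zero).mp h2
    have hshell : MU2 * ∑ i ∈ sh, ‖⟪b i, S₀ w⟫_𝕜‖ ^ 2 ≤
        ∑ i ∈ sh, (RCLike.re lt - ℓ i - s) * ‖⟪b i, S₀ w⟫_𝕜‖ ^ 2 -
          RCLike.re ⟪T (Ainv (U.starProjection (T w), 0)).1, S₀ w⟫_𝕜 := by
      rw [hcross]
      exact hshellM e he0
    have h := tail_coercive_of_structure_nested b ℓ x₀ d hd T lt U hS₀U Ainv hAinvU (S₀ wt) hw hSw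
      (basis_mem_or_mem_orthogonal b K) hgB sh (hpair T hTt hTband' w hw) hshell
      (fun i hi hi' => htail i (fun h => hi ((span 𝕜 (b '' (K : Set ι))).le_topologicalClosure
        (subset_span ⟨i, h, rfl⟩))) hi') hrank
    refine le_trans (mul_le_mul_of_nonneg_right ?_ (sq_nonneg _)) h
    rw [hμdef]
    nlinarith [mul_le_mul_of_nonneg_left hnt' hgB]
  -- the residual
  have hres' : ‖((1 : H →L[𝕜] H) - T - ((x₀ : 𝕜) - lt) • S₀) wt‖ ≤ r₀ := by
    have h2 : ‖((1 : H →L[𝕜] H) - T - ((x₀ : 𝕜) - lt) • S₀) wt‖ ^ 2 ≤ r₀ ^ 2 := by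
      rw [hwt, hS₀, residual_norm_sq_eq b ℓ x₀ d hd T lt nbr hsymm hTband Kv vt]
      exact hres
    exact (pow_le_pow_iff_left₀ (norm_nonneg _) hr₀ two_ne_zero).mp h2
  -- compose
  have hκ' : 2 * Real.sqrt 2 *
      (√((1 + βC ^ 2) / μ ^ 2 + (α + βB * √(1 + βC ^ 2) / μ) ^ 2)) ^ 2 * r₀ < 1 := by
    rw [← hMdef]; exact hκ
  have main := BorderedEigenpairMasterNested.certified_eigenpair_of_row_nested S₀ T hS₀c hS₀inj hTu
    (x₀ : 𝕜) lt U hS₀U hS₀U' wt vr hvr Ainv hAleft hμ hα hβB hβC hr₀ hαb hβBb hβCb hcoer hres' hκ'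
  rw [← hMdef, hvc] at main
  exact main

end Summit.NavierStokesRegularity.FluidComputer.BorderedEigenpairFromSections

end
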